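import Literature.Probability.Percolation.AltFourArmInterfaceCrossings
import Literature.Probability.Percolation.AltFourArmOfCrossingLoops
import HarnessLib

/-!
# Four alternating arms force interface loops of a finite configuration to traverse the shell

Topic: Probability / Percolation. Proof-only file (no definitions, no named facts) serving the
named fact `Literature.Probability.Percolation.fourArm_exponent` (S. Smirnov, W. Werner, Math.
Res. Lett. **8** (2001), Thm. 4 of arXiv `math/0109120`, `j = 4`) through its continuum input
(16)₄, the scaling limit of the alternating four-arm probabilities, along the loop-ensemble route
of `AltFourArmOfInterfaces.lean` / `AltFourArmOfCrossingLoops.lean` (loops ⇒ arms) and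
`AltFourArmInterfaceCrossings.lean` (arms ⇒ one interface loop of a modified configuration with
four annulus stretches). Smirnov–Werner, §4 Remark 6 and (15): the `j`-arm probabilities are read
on the discrete interfaces, "the probability of the existence of `j` disjoint crossings of the
annulus by interfaces"; Garban–Pete–Schramm 2013, §2.4: four alternating arms ⇔ at least four
interfaces cross. This file proves the **converse lattice direction, arms ⇒ loops, for the
loop collection of a FINITE configuration** (the object whose law converges in the Camia–Newman
theorem, `CLE6.lean`): the four annulus stretches of `AltFourArmInterfaceCrossings.lean` live on an
interface loop `w` of the MODIFIED configuration `{|v| < r} ∪ (ω ∩ {|v| ≤ R})`; along each stretch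
both crossed sites lie in the annulus, where any configuration `ξ` agreeing with `ω` has the same
interface-successor map, so each stretch is an initial segment of an interface loop of `ξ`
(Bollobás–Riordan 2006, Ch. 7 p. 178: interfaces follow the deterministic right/left rule).

* `exists_isSiteInterfaceLoop_getVert_eq`, `exists_isSiteInterfaceLoop_carrying_stretch` — an
  interface walk of a finite configuration is a prefix of the interface loop based at its first
  face; applied to the annulus stretches of `w` transported to `ξ`;
* `IsSiteInterfaceLoop.hasTraversals_of_vertices` — separated vertex-index traversals of an
  interface loop give traversals in time of its polygon `hexLoopCurve δ w`
  (`Curve.HasTraversals`, Aizenman–Burchard), radii worsened by `2δ`;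
* `hasTraversals_three_of_stretches_same_trace` — the combinatorial heart: if the loops of `ξ`
  carrying the four stretches all have ONE trace, they are rotations of one loop `W₀`
  (`IsSiteInterfaceLoop.mem_support_iff_of_mem_support`, `IsSiteInterfaceLoop.getVert_eq_getVert'`), the four stretches are vertex-disjoint
  stretches of the cycle `w`, hence occupy disjoint index intervals of `W₀` read from its base
  face on stretch `0`; sorting the other three (`Finset.orderEmbOfFin`) gives three separated
  vertex traversals of `W₀`, hence `HasTraversals 3`;
* `exists_interfaceLoops_of_mem_altFourArm` — **the dichotomy**: for `ω ∈ altFourArm r R` and a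
  finite `ξ` agreeing with `ω` on the annulus, either two interface loops of `ξ` with different
  traces both cross `{δ r < |z| < (√3/2) δ (R+1) - δ}`, or one interface loop of `ξ` has three
  separate traversals of the slightly smaller shell;
* `triLoopCollection_traversals_of_mem_altFourArm` — the same read on the Camia–Newman loop
  collection `triLoopCollection D δ ω` of a Jordan domain `D ⊇ B̄(0, δ R)` (the restricted
  configuration is finite and agrees with `ω` on the annulus): a member with a representative
  traversing three times, or two members with different traces both crossing — the shape of the
  event `loopShellTraversal` of the lower-half file.

Together with `mem_altFourArm_of_hasTraversals_*` (loops ⇒ arms) this completes the two lattice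
directions of the dictionary; what remains for (16)₄ along this route is the portmanteau upper
half (closed near-miss events: two DIFFERENT crossing traces at vanishing distance, which needs an
a-priori bound) and the continuum evaluation of the Camia–Newman limit of the traversal event
(Smirnov–Werner (12)–(14); Lawler–Schramm–Werner). No named fact is introduced.

## References

* S. Smirnov, W. Werner, *Critical exponents for two-dimensional percolation*, Math. Res. Lett. 8
  (2001) 729–744, §4, Remark 6, (15), (16) [SmirnovWernerMRL2001].
* C. Garban, G. Pete, O. Schramm, *Pivotal, cluster and interface measures for critical planar
  percolation*, J. Amer. Math. Soc. 26 (2013), §2.4 [GarbanPeteSchramm2013Pivotal].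
* F. Camia, C. M. Newman, *Two-dimensional critical percolation: the full scaling limit*, Comm.
  Math. Phys. 268 (2006), §2 and §4 [CamiaNewman2006].
* B. Bollobás, O. Riordan, *Percolation*, CUP (2006), Ch. 7 p. 178 [BollobasRiordan2006].
* M. Aizenman, A. Burchard, Duke Math. J. 99 (1999), §1 (1.3) [AizenmanBurchardDuke1999].
-/

noncomputable section

open Set Metric Complex Filter MeasureTheory
open Literature.Topology.PlaneTopology Literature.Probability.RandomPlanarGeometry
open scoped unitInterval Topology

namespace Literature.Probability.Percolation

open LatticeModels

/-! ### An interface walk of a finite configuration is a prefix of the interface loop at its first face -/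

/-- **An interface walk of a configuration with finitely many open sites is an initial segment of
the interface loop based at its first face**: there is an interface loop `W` based at the first
face of the walk `p` with `p.getVert i = W.getVert (i % n)` for all `i ≤ p.length` (both follow
the interface-successor map `ifaceSucc`; Bollobás–Riordan 2006, Ch. 7 p. 178). [cite: BollobasRiordan2006, Ch. 7 p. 178] -/
theorem exists_isSiteInterfaceLoop_getVert_eq {ξ : SiteConfig (Site 2)} (hfin : ξ.Finite) {F G : HexVertex}
    (p : hexGraph.Walk F G) (e : ℕ → triGraph.Dart)
    (he : ∀ i < p.length, triEdgeFaces (e i) = (p.getVert (i + 1), p.getVert i) ∧ (e i).fst ∈ ξ ∧ (e i).snd ∉ ξ)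
    (hlen : 0 < p.length) :
    ∃ W : hexGraph.Walk F F, IsSiteInterfaceLoop ξ W ∧ ∀ i ≤ p.length, p.getVert i = W.getVert (i % W.length) := by
  obtain ⟨hf0, ho0, hc0⟩ := he 0 hlen
  have hd0 : e 0 = ⟨((e 0).fst, (e 0).snd), (e 0).adj⟩ := rfl
  rw [hd0] at hf0
  obtain ⟨F₀, W, hW, hfaces⟩ := exists_isSiteInterfaceLoop_of_adj hfin (e 0).adj ho0 hc0
  have hb := hf0.symm.trans hfaces
  simp only [Prod.mk.injEq, zero_add, SimpleGraph.Walk.getVert_zero] at hb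
  obtain ⟨hb1, rfl⟩ := hb
  have hWlen : 0 < W.length := by have := hW.isCycle.three_le_length; omega
  refine ⟨W, hW, ?_⟩
  have hsucc : ∀ k < p.length, ifaceSucc ξ (p.getVert k) = some (p.getVert (k + 1)) := by
    intro k hk
    obtain ⟨hf, ho, hc⟩ := he k hk
    have hd : e k = ⟨((e k).fst, (e k).snd), (e k).adj⟩ := rfl
    rw [hd] at hf
    exact ifaceSucc_eq_some_of_triEdgeFaces (e k).adj hf ho hc
  intro i
  induction i with
  | zero => intro; rw [Nat.zero_mod, SimpleGraph.Walk.getVert_zero, SimpleGraph.Walk.getVert_zero]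
  | succ i ih =>
    intro hi
    have h1 := hsucc i (by omega)
    rw [ih (by omega), hW.ifaceSucc_getVert (Nat.mod_lt _ hWlen)] at h1
    have h2 : W.getVert (i % W.length + 1) = p.getVert (i + 1) := Option.some_injective _ h1
    rw [← h2]
    have hW3 := hW.isCycle.three_le_length
    have h1mod : 1 % W.length = 1 := Nat.one_mod_eq_one.2 (by omega)
    -- `(i + 1) % n` is `i % n + 1` or `0 = n`
    by_cases h : i % W.length + 1 < W.length
    · congr 1
      rw [Nat.add_mod, h1mod, Nat.mod_eq_of_lt h]
    · have e1 : i % W.length + 1 = W.length := by have := Nat.mod_lt i hWlen; omega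
      have e2 : (i + 1) % W.length = 0 := by
        rw [Nat.add_mod, h1mod, e1, Nat.mod_self]
      rw [e1, e2, SimpleGraph.Walk.getVert_length, SimpleGraph.Walk.getVert_zero]

/-! ### From separated vertex traversals to traversals in time -/

section V2T

variable {ω : SiteConfig (Site 2)} {f₀ : HexVertex} {w : hexGraph.Walk f₀ f₀}
  (hw : IsSiteInterfaceLoop ω w) {δ : ℝ} (hδ : 0 < δ)

include hw hδ

/-- **Separated vertex traversals give separate traversals in time.** If `α i < β i < n`
(`i < k`) with `β i < α j` for `i < j`, and the vertex `polyPt (α i)` is within `ρ` of `x` and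
`polyPt (β i)` at distance `≥ R` (or conversely), then the polygon traverses `D(x; ρ + 2δ, R - 2δ)`
`k` times (at the times of these piece indices, `exists_time_near_polyPt`). [cite: AizenmanBurchardDuke1999, §1 (1.3)] -/
theorem IsSiteInterfaceLoop.hasTraversals_of_vertices {k : ℕ} {x : ℂ} {ρ R : ℝ} (α β : Fin k → ℕ)
    (hαβ : ∀ i, α i < β i) (hβ : ∀ i, β i < w.length) (hsep : ∀ i j, i < j → β i < α j)
    (hrad : ∀ i, (dist (polyPt δ w (α i)) x ≤ ρ ∧ R ≤ dist (polyPt δ w (β i)) x) ∨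
      (R ≤ dist (polyPt δ w (α i)) x ∧ dist (polyPt δ w (β i)) x ≤ ρ)) :
    (hexLoopCurve δ w).HasTraversals k x (ρ + 2 * δ) (R - 2 * δ) := by
  have hs : ∀ i, ∃ u : I, polyIdx w.length u = α i ∧ dist (hexLoopCurve δ w u) (polyPt δ w (α i)) ≤ 2 * δ :=
    fun i ↦ hw.exists_time_near_polyPt hδ ((hαβ i).trans (hβ i))
  have ht : ∀ i, ∃ u : I, polyIdx w.length u = β i ∧ dist (hexLoopCurve δ w u) (polyPt δ w (β i)) ≤ 2 * δ :=
    fun i ↦ hw.exists_time_near_polyPt hδ (hβ i)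
  choose s hs hsd using hs
  choose t ht htd using ht
  refine ⟨s, t, fun i ↦ ⟨(lt_of_polyIdx_lt (by rw [hs, ht]; exact hαβ i)).le, ?_⟩, fun i j hij ↦ lt_of_polyIdx_lt (by rw [ht, hs]; exact hsep i j hij)⟩
  rcases hrad i with ⟨h1, h2⟩ | ⟨h1, h2⟩
  · left
    constructor
    · linarith [dist_triangle (hexLoopCurve δ w (s i)) (polyPt δ w (α i)) x, hsd i]
    · linarith [dist_triangle (polyPt δ w (β i)) (hexLoopCurve δ w (t i)) x, dist_comm (polyPt δ w (β i)) (hexLoopCurve δ w (t i)), htd i]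
  · right
    constructor
    · linarith [dist_triangle (polyPt δ w (α i)) (hexLoopCurve δ w (s i)) x, dist_comm (polyPt δ w (α i)) (hexLoopCurve δ w (s i)), hsd i]
    · linarith [dist_triangle (hexLoopCurve δ w (t i)) (polyPt δ w (β i)) x, htd i]

end V2T


/-! ### Two interface loops from the same face agree face by face -/

/-- Two interface loops of `ξ` whose base faces coincide (propositionally) agree face by face up
to the shorter length (both follow `ifaceSucc`; cf. `IsSiteInterfaceLoop.getVert_eq_getVert` for
loops of the same type). [cite: BollobasRiordan2006, Ch. 7 p. 178] -/
theorem IsSiteInterfaceLoop.getVert_eq_getVert' {ξ : SiteConfig (Site 2)} {F F' : HexVertex} {W : hexGraph.Walk F F}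
    {W' : hexGraph.Walk F' F'} (hW : IsSiteInterfaceLoop ξ W) (hW' : IsSiteInterfaceLoop ξ W') (h0 : W.getVert 0 = W'.getVert 0) :
    ∀ i, i ≤ W.length → i ≤ W'.length → W.getVert i = W'.getVert i
  | 0, _, _ => h0
  | i + 1, hi, hi' => by
    have h1 := hW.ifaceSucc_getVert (i := i) (by omega)
    have h2 := hW'.ifaceSucc_getVert (i := i) (by omega)
    rw [hW.getVert_eq_getVert' hW' h0 i (by omega) (by omega)] at h1
    rw [h1] at h2
    exact Option.some_injective _ h2

/-! ### The interface loop of a finite configuration carrying a clean stretch -/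

/-- **A clean stretch of the loop of the modified configuration lies on an interface loop of any
finite configuration agreeing with `ω` on the annulus.** Let `w` be an interface loop of
`ω₁ = {|·| < r} ∪ (ω ∩ {|·| ≤ R})` and `a < b ≤ n` indices such that every dart strictly between
has its left site open and its right site closed in `ω`, both in the annulus `{r ≤ |·| ≤ R}`, with
at least one such dart (`a + 1 < b`). If `ξ` is a configuration with finitely many open sites
agreeing with `ω` on the annulus, the interface loop `W` of `ξ` based at the face
`w.getVert (a + 1)` carries the stretch: `w.getVert (a + 1 + i) = W.getVert (i % n_W)` for
`i ≤ b - 1 - a`. [cite: BollobasRiordan2006, Ch. 7 p. 178] [cite: CamiaNewman2006, §4] -/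
theorem exists_isSiteInterfaceLoop_carrying_stretch {ω : SiteConfig (Site 2)} {r R : ℕ} {F₀ : HexVertex} {w : hexGraph.Walk F₀ F₀}
    (hw : IsSiteInterfaceLoop {v : Site 2 | triNorm v < r ∨ (v ∈ ω ∧ triNorm v ≤ R)} w)
    {a b : ℕ} (hab : a + 1 < b) (hb : b ≤ w.length)
    (hann : ∀ j, a < j → j < b →
      ((r : ℤ) ≤ triNorm (hw.lv j) ∧ triNorm (hw.lv j) ≤ R) ∧ ((r : ℤ) ≤ triNorm (hw.rv j) ∧ triNorm (hw.rv j) ≤ R) ∧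
        hw.lv j ∈ ω ∧ hw.rv j ∉ ω)
    {ξ : SiteConfig (Site 2)} (hfin : ξ.Finite) (hagree : ∀ v : Site 2, (r : ℤ) ≤ triNorm v ∧ triNorm v ≤ R → (v ∈ ξ ↔ v ∈ ω)) :
    ∃ W : hexGraph.Walk (w.getVert (a + 1)) (w.getVert (a + 1)), IsSiteInterfaceLoop ξ W ∧
      ∀ i ≤ b - 1 - a, w.getVert (a + 1 + i) = W.getVert (i % W.length) := by
  set m := b - 1 - a with hm
  have hGv : (w.drop (a + 1)).getVert m = w.getVert b := by
    rw [SimpleGraph.Walk.drop_getVert]; congr 1; omega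
  set p : hexGraph.Walk (w.getVert (a + 1)) (w.getVert b) := ((w.drop (a + 1)).take m).copy rfl hGv with hp
  have hplen : p.length = m := by
    rw [hp, SimpleGraph.Walk.length_copy, SimpleGraph.Walk.take_length, SimpleGraph.Walk.drop_length]
    omega
  have hpget : ∀ k ≤ m, p.getVert k = w.getVert (a + 1 + k) := by
    intro k hk
    rw [hp, SimpleGraph.Walk.getVert_copy, SimpleGraph.Walk.take_getVert, SimpleGraph.Walk.drop_getVert,
      min_eq_right hk]
  have hlen : 0 < w.length := by omega
  set e : ℕ → triGraph.Dart := fun k ↦ if h : a + 1 + k < w.length then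
    ⟨(hw.lv (a + 1 + k), hw.rv (a + 1 + k)), hw.adj_lv_rv h⟩ else ⟨(hw.lv 0, hw.rv 0), hw.adj_lv_rv hlen⟩ with he
  have hek : ∀ (k : ℕ) (hk : k < m), e k = ⟨(hw.lv (a + 1 + k), hw.rv (a + 1 + k)), hw.adj_lv_rv (by omega)⟩ := by
    intro k hk
    simp only [he, dif_pos (show a + 1 + k < w.length by omega)]
  have hiface : ∀ i < p.length, triEdgeFaces (e i) = (p.getVert (i + 1), p.getVert i) ∧ (e i).fst ∈ ξ ∧ (e i).snd ∉ ξ := by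
    intro k hk
    rw [hplen] at hk
    have hJ : a + 1 + k < w.length := by omega
    obtain ⟨h', hf, -, -⟩ := hw.dart_spec hJ
    obtain ⟨a1, a2, a3, a4⟩ := hann (a + 1 + k) (by omega) (by omega)
    rw [hek k hk, hpget k (by omega), hpget (k + 1) (by omega)]
    refine ⟨?_, ?_, ?_⟩
    · rw [show a + 1 + (k + 1) = a + 1 + k + 1 by omega]; exact hf
    · change hw.lv (a + 1 + k) ∈ ξ
      exact (hagree _ a1).2 a3
    · change hw.rv (a + 1 + k) ∉ ξ
      exact fun h ↦ a4 ((hagree _ a2).1 h)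
  obtain ⟨W, hW, hget⟩ := exists_isSiteInterfaceLoop_getVert_eq hfin p e hiface (by rw [hplen]; omega)
  refine ⟨W, hW, fun i hi ↦ ?_⟩
  rw [← hpget i hi]
  exact hget i (by rw [hplen]; exact hi)

/-! ### Face centres at the two ends of a stretch -/

/-- **A face with a vertex inside `Λ̊_r` has its centre within `δ r` of the origin** (at mesh
`δ > 0`; the centre is within `δ` of each vertex, a vertex of norm `≤ r - 1` has its mesh point
within `δ (r - 1)`). [folklore] -/
theorem norm_hexCenter_le_of_inner {δ : ℝ} (hδ : 0 < δ) {r : ℕ} {F : HexVertex} (h : ∃ v ∈ hexFaceVertices F, triNorm v < r) :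
    ‖(δ : ℂ) * hexCenter F‖ ≤ δ * r := by
  obtain ⟨v, hv, hvr⟩ := h
  have h1 := dist_triMeshPoint_hexCenter_le hv δ
  rw [abs_of_pos hδ] at h1
  have h2 : ‖triMeshPoint δ v‖ ≤ δ * (r - 1) := by
    rw [norm_triMeshPoint_eq hδ.le]
    have := norm_triEmbed_le_triNorm v
    have hvr' : (triNorm v : ℝ) ≤ r - 1 := by
      have : triNorm v ≤ r - 1 := by omega
      exact_mod_cast this
    nlinarith
  have := norm_le_norm_add_norm_sub' ((δ : ℂ) * hexCenter F) (triMeshPoint δ v)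
  rw [← dist_eq_norm, dist_comm] at this
  nlinarith

/-- **A face with a vertex off `Λ_R` has its centre at distance `≥ (√3/2) δ (R + 1) - δ` from the
origin.** [folklore] -/
theorem le_norm_hexCenter_of_outer {δ : ℝ} (hδ : 0 < δ) {R : ℕ} {F : HexVertex} (h : ∃ v ∈ hexFaceVertices F, (R : ℤ) < triNorm v) :
    Real.sqrt 3 / 2 * δ * (R + 1) - δ ≤ ‖(δ : ℂ) * hexCenter F‖ := by
  obtain ⟨v, hv, hvR⟩ := h
  have h1 := dist_triMeshPoint_hexCenter_le hv δ
  rw [abs_of_pos hδ] at h1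
  have h2 : Real.sqrt 3 / 2 * δ * (R + 1) ≤ ‖triMeshPoint δ v‖ := by
    rw [norm_triMeshPoint_eq hδ.le]
    have := mul_triNorm_le_norm_triEmbed v
    have hvR' : (R : ℝ) + 1 ≤ triNorm v := by
      have : (R : ℤ) + 1 ≤ triNorm v := by omega
      exact_mod_cast this
    have hs : (0 : ℝ) ≤ Real.sqrt 3 / 2 := by positivity
    nlinarith [mul_le_mul_of_nonneg_left hvR' hs]
  have := norm_le_norm_add_norm_sub' (triMeshPoint δ v) ((δ : ℂ) * hexCenter F)
  rw [← dist_eq_norm] at this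
  linarith

/-- The centre of the `i`-th face of a walk (for `i ≤ n`) is on its polygonal trace. [folklore] -/
theorem hexCenter_getVert_mem_polyTrace {F G : HexVertex} (W : hexGraph.Walk F G) (hlen : 0 < W.length) (δ : ℝ)
    {i : ℕ} (hi : i ≤ W.length) : (δ : ℂ) * hexCenter (W.getVert i) ∈ polyTrace δ W := by
  rcases Nat.lt_or_ge i W.length with h | h
  · exact polyPiece_subset_polyTrace h (left_mem_segment _ _ _)
  · obtain rfl : i = W.length := le_antisymm hi h
    have : (δ : ℂ) * hexCenter (W.getVert W.length) = polyPt δ W (W.length - 1 + 1) := by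
      rw [polyPt, show W.length - 1 + 1 = W.length by omega]
    rw [this]
    exact polyPiece_subset_polyTrace (by omega) (right_mem_segment _ _ _)

/-- **Nonempty stretches**: a face cannot have both a vertex in `Λ̊_r` and a vertex off `Λ_R` when
`r ≤ R` (vertices of one face differ in norm by at most one). [folklore] -/
theorem lt_of_inner_outer_faces {r R : ℕ} (hrR : r ≤ R) {F₀ : HexVertex} {w : hexGraph.Walk F₀ F₀} {a b : ℕ} (hab : a < b)
    (hA : ∃ v ∈ hexFaceVertices (w.getVert (a + 1)), triNorm v < r) (hB : ∃ v ∈ hexFaceVertices (w.getVert b), (R : ℤ) < triNorm v) :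
    a + 1 < b := by
  by_contra h
  have e : a + 1 = b := by omega
  rw [e] at hA
  obtain ⟨v, hv, hvr⟩ := hA
  obtain ⟨u, hu, huR⟩ := hB
  have := triNorm_le_of_mem_hexFaceVertices hv hu
  omega

/-- The same with the roles of the two ends exchanged. [folklore] -/
theorem lt_of_outer_inner_faces {r R : ℕ} (hrR : r ≤ R) {F₀ : HexVertex} {w : hexGraph.Walk F₀ F₀} {a b : ℕ} (hab : a < b)
    (hA : ∃ v ∈ hexFaceVertices (w.getVert (a + 1)), (R : ℤ) < triNorm v) (hB : ∃ v ∈ hexFaceVertices (w.getVert b), triNorm v < r) :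
    a + 1 < b := by
  by_contra h
  have e : a + 1 = b := by omega
  rw [e] at hA
  obtain ⟨v, hv, hvR⟩ := hA
  obtain ⟨u, hu, hur⟩ := hB
  have := triNorm_le_of_mem_hexFaceVertices hu hv
  omega


/-- Two interface loops of `ξ` from the same face have the same length. [cite: BollobasRiordan2006, Ch. 7 p. 178] -/
theorem IsSiteInterfaceLoop.length_eq' {ξ : SiteConfig (Site 2)} {F F' : HexVertex} {W : hexGraph.Walk F F}
    {W' : hexGraph.Walk F' F'} (hW : IsSiteInterfaceLoop ξ W) (hW' : IsSiteInterfaceLoop ξ W') (h0 : W.getVert 0 = W'.getVert 0) :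
    W.length = W'.length := by
  by_contra hne
  rcases lt_or_gt_of_ne hne with hlt | hlt
  · have h := hW.getVert_eq_getVert' hW' h0 W.length le_rfl hlt.le
    rw [SimpleGraph.Walk.getVert_length] at h
    have h0' : W'.getVert 0 = W'.getVert W.length := by
      rw [← h, ← h0, SimpleGraph.Walk.getVert_zero]
    have := hW'.isCycle.getVert_injOn' (by simp) (by simp only [Set.mem_setOf_eq]; omega) h0'
    have h3 := hW.isCycle.three_le_length
    omega
  · have h := hW.getVert_eq_getVert' hW' h0 W'.length hlt.le le_rfl
    rw [SimpleGraph.Walk.getVert_length] at h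
    have h0' : W.getVert 0 = W.getVert W'.length := by
      rw [h, h0, SimpleGraph.Walk.getVert_zero]
    have := hW.isCycle.getVert_injOn' (by simp) (by simp only [Set.mem_setOf_eq]; omega) h0'
    have h3 := hW'.isCycle.three_le_length
    omega

/-- **Faces of a cycle are distinct**, in the form used below: if `w.getVert i = w.getVert j` with
`1 ≤ i ≤ n`, `j ≤ n - 1` then `i = j` or (`i = n` and `j = 0`). [folklore] -/
theorem getVert_eq_getVert_iff_of_isCycle {F₀ : HexVertex} {w : hexGraph.Walk F₀ F₀} (hc : w.IsCycle) {i j : ℕ}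
    (hi1 : 1 ≤ i) (hi : i ≤ w.length) (hj : j + 1 ≤ w.length) (h : w.getVert i = w.getVert j) : i = j ∨ (i = w.length ∧ j = 0) := by
  rcases Nat.lt_or_ge i w.length with hlt | hge
  · left
    exact hc.getVert_injOn' (by simp only [Set.mem_setOf_eq]; omega) (by simp only [Set.mem_setOf_eq]; omega) h
  · obtain rfl : i = w.length := le_antisymm hi hge
    have h' : w.getVert 0 = w.getVert j := by
      rw [SimpleGraph.Walk.getVert_zero, ← h, SimpleGraph.Walk.getVert_length]
    have := hc.getVert_injOn' (by simp) (by simp only [Set.mem_setOf_eq]; omega) h'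
    exact Or.inr ⟨rfl, this.symm⟩


/-- **Faces `1, …, n` of a cycle are pairwise distinct.** [folklore] -/
theorem getVert_injOn_Icc_one_of_isCycle {F₀ : HexVertex} {w : hexGraph.Walk F₀ F₀} (hc : w.IsCycle) {i i' : ℕ}
    (hi1 : 1 ≤ i) (hi : i ≤ w.length) (hi'1 : 1 ≤ i') (hi' : i' ≤ w.length) (h : w.getVert i = w.getVert i') : i = i' := by
  rcases Nat.lt_or_ge i' w.length with hlt | hge
  · rcases getVert_eq_getVert_iff_of_isCycle hc hi1 hi (by omega) h with h' | h'
    · exact h'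
    · omega
  · rcases Nat.lt_or_ge i w.length with hlt' | hge'
    · rcases getVert_eq_getVert_iff_of_isCycle hc hi'1 hi' (by omega) h.symm with h' | h'
      · exact h'.symm
      · omega
    · omega

/-! ### Four stretches on one trace: three separated traversals -/

/-- **Stretches of one interface loop on a common trace give three separated traversals in time.**
Let `w` be a cycle of the hexagonal lattice and `[a₀ + 1, b₀]`, `[a k + 1, b k]` (`k < 3`) four
pairwise disjoint index intervals of nonempty stretches (`a + 1 < b ≤ n`, the first one before the
others). Suppose interface loops `W₀` and `W k` of a configuration `ξ` are based at the faces
`w.getVert (a₀ + 1)` and `w.getVert (a k + 1)`, the `W k` carry their stretches as prefixes, and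
all have the trace of `W₀`. Then the three stretches `k < 3` occupy pairwise disjoint, non-wrapping index
intervals of `W₀` (loops with a common trace are rotations of one another; a wrapping interval
would contain the base face of `W₀`, a face of the first stretch), so if the end faces of each are
within `ρ` and beyond `Rad` of the origin (in either order), the polygon of `W₀` traverses
`D(0; ρ + 2δ, Rad - 2δ)` three times (`hasTraversals_of_vertices`). [cite: CamiaNewman2006, §2 and §4] [cite: AizenmanBurchardDuke1999, §1 (1.3)] -/
theorem hasTraversals_three_of_stretches_same_trace {ξ : SiteConfig (Site 2)} {F₀ : HexVertex} {w : hexGraph.Walk F₀ F₀}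
    (hc : w.IsCycle) {δ : ℝ} (hδ : 0 < δ) {ρ Rad : ℝ}
    {a₀ b₀ : ℕ} (h0 : a₀ + 1 < b₀) (hb₀ : b₀ ≤ w.length)
    (a b : Fin 3 → ℕ) (hlt : ∀ k, a k + 1 < b k) (hbn : ∀ k, b k ≤ w.length) (h0a : ∀ k, b₀ ≤ a k)
    (hdis : ∀ k k', k ≠ k' → b k ≤ a k' ∨ b k' ≤ a k)
    {f₀ : HexVertex} (hf₀ : f₀ = w.getVert (a₀ + 1)) {W₀ : hexGraph.Walk f₀ f₀} (hW₀ : IsSiteInterfaceLoop ξ W₀)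
    {f : Fin 3 → HexVertex} (hf : ∀ k, f k = w.getVert (a k + 1))
    (W : ∀ k, hexGraph.Walk (f k) (f k)) (hW : ∀ k, IsSiteInterfaceLoop ξ (W k))
    (hpre : ∀ k, ∀ i ≤ b k - 1 - a k, w.getVert (a k + 1 + i) = (W k).getVert (i % (W k).length))
    (htr : ∀ k, polyTrace δ (W k) = polyTrace δ W₀)
    (hends : ∀ k, (‖(δ : ℂ) * hexCenter (w.getVert (a k + 1))‖ ≤ ρ ∧ Rad ≤ ‖(δ : ℂ) * hexCenter (w.getVert (b k))‖) ∨
      (Rad ≤ ‖(δ : ℂ) * hexCenter (w.getVert (a k + 1))‖ ∧ ‖(δ : ℂ) * hexCenter (w.getVert (b k))‖ ≤ ρ)) :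
    (hexLoopCurve δ W₀).HasTraversals 3 0 (ρ + 2 * δ) (Rad - 2 * δ) := by
  classical
  set n := w.length with hn
  set n' := W₀.length with hn'
  have hn'3 : 3 ≤ n' := hW₀.three_le_length
  -- injectivity of the faces `1, …, n` of `w`
  have hinj : ∀ {i i' : ℕ}, 1 ≤ i → i ≤ n → 1 ≤ i' → i' ≤ n → w.getVert i = w.getVert i' → i = i' :=
    fun h1 h2 h3 h4 h ↦ getVert_injOn_Icc_one_of_isCycle hc h1 h2 h3 h4 h
  set m : Fin 3 → ℕ := fun k ↦ b k - 1 - a k with hm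
  have hmdef : ∀ k, m k = b k - 1 - a k := fun k ↦ rfl
  have hm1 : ∀ k, 1 ≤ m k := fun k ↦ by rw [hmdef]; have := hlt k; omega
  have hmb : ∀ k, a k + 1 + m k = b k := fun k ↦ by rw [hmdef]; have := hlt k; omega
  /- S1: the base face of `W k` is a face of `W₀` -/
  have hFmem : ∀ k, w.getVert (a k + 1) ∈ W₀.support := by
    intro k
    have hlenk : 0 < (W k).length := by have := (hW k).three_le_length; omega
    have hz0 : (δ : ℂ) * hexCenter (w.getVert (a k + 1)) ∈ polyPiece δ (W k) 0 := by
      have : (δ : ℂ) * hexCenter (w.getVert (a k + 1)) = polyPt δ (W k) 0 := by rw [polyPt, SimpleGraph.Walk.getVert_zero, hf]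
      rw [this]; exact left_mem_segment _ _ _
    have hzt : (δ : ℂ) * hexCenter (w.getVert (a k + 1)) ∈ polyTrace δ W₀ := by
      rw [← htr k]; exact polyPiece_subset_polyTrace hlenk hz0
    obtain ⟨j, hj, hzj⟩ := mem_polyTrace_iff.1 hzt
    obtain ⟨u, hu, hu'⟩ := exists_mem_support_of_mem_polyPiece hδ.ne' hlenk hj hz0 hzj
    exact ((hW k).mem_support_iff_of_mem_support hW₀ hu hu' _).1 (hf k ▸ (W k).start_mem_support)
  /- S2: its position `j k` in `W₀`, with `1 ≤ j k < n'` -/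
  have hjex : ∀ k, ∃ j, 1 ≤ j ∧ j < n' ∧ W₀.getVert j = w.getVert (a k + 1) := by
    intro k
    obtain ⟨j, hj, hjn⟩ := SimpleGraph.Walk.mem_support_iff_exists_getVert.1 (hFmem k)
    -- normalise `j < n'`
    obtain ⟨j', hj'n, hj'⟩ : ∃ j', j' < n' ∧ W₀.getVert j' = w.getVert (a k + 1) := by
      rcases Nat.lt_or_ge j n' with h | h
      · exact ⟨j, h, hj⟩
      · obtain rfl : j = n' := le_antisymm hjn h
        refine ⟨0, by omega, ?_⟩
        rw [SimpleGraph.Walk.getVert_zero, ← hj, hn', SimpleGraph.Walk.getVert_length]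
    refine ⟨j', ?_, hj'n, hj'⟩
    by_contra hj0
    have e : j' = 0 := by omega
    rw [e, SimpleGraph.Walk.getVert_zero, hf₀] at hj'
    -- `w.getVert (a₀ + 1) = w.getVert (a k + 1)`: impossible
    have := hinj (by omega) (by omega) (by omega) (by have := hbn k; have := hlt k; omega) hj'
    have := h0a k
    omega
  choose j hj1 hjn hjF using hjex
  /- S3: `W k` has length `n'` and agrees with `W₀` rotated at `j k` -/
  have hVi : ∀ k, IsSiteInterfaceLoop ξ (W₀.rotateAt (j k)) := fun k ↦ hW₀.rotateAt (hj1 k) (hjn k).le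
  have hV0 : ∀ k, (W k).getVert 0 = (W₀.rotateAt (j k)).getVert 0 := by
    intro k
    rw [SimpleGraph.Walk.getVert_zero, SimpleGraph.Walk.getVert_rotateAt, if_pos (by have := hjn k; omega)]
    simp only [add_zero]
    rw [hf]
    exact (hjF k).symm
  have hlenk : ∀ k, (W k).length = n' := fun k ↦ by
    rw [(hW k).length_eq' (hVi k) (hV0 k), SimpleGraph.Walk.length_rotateAt _ (hjn k).le]
  have hWV : ∀ k, ∀ i ≤ n', (W k).getVert i = (W₀.rotateAt (j k)).getVert i := fun k i hi ↦
    (hW k).getVert_eq_getVert' (hVi k) (hV0 k) i (by rw [hlenk]; exact hi)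
      (by rw [SimpleGraph.Walk.length_rotateAt _ (hjn k).le]; exact hi)
  /- S3': the stretch is shorter than the loop: `m k < n'` -/
  have hmn : ∀ k, m k < n' := by
    intro k
    by_contra hge
    push Not at hge
    have h1 := hpre k n' (by rw [← hmdef]; exact hge)
    rw [hlenk, Nat.mod_self, SimpleGraph.Walk.getVert_zero, hf] at h1
    have := hinj (by omega) (by have := hbn k; have := hmdef k; have := hlt k; omega) (by omega)
      (by have := hbn k; have := hlt k; omega) h1
    omega
  -- the stretch faces as faces of `W₀`, before checking the wrap
  have hface : ∀ k, ∀ i ≤ m k, w.getVert (a k + 1 + i) = (W₀.rotateAt (j k)).getVert i := by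
    intro k i hi
    rw [hpre k i hi, hlenk, Nat.mod_eq_of_lt (by have := hmn k; omega)]
    exact hWV k i (by have := hmn k; omega)
  /- S4: no wrap: `j k + m k < n'` -/
  have hnowrap : ∀ k, j k + m k < n' := by
    intro k
    by_contra hge
    push Not at hge
    set i₀ := n' - j k with hi₀
    have hi₀m : i₀ ≤ m k := by omega
    have h1 := hface k i₀ hi₀m
    rw [SimpleGraph.Walk.getVert_rotateAt, if_neg (by omega), show i₀ - (n' - j k) = 0 by omega, Nat.min_zero,
      SimpleGraph.Walk.getVert_zero, hf₀] at h1
    -- `w.getVert (a k + 1 + i₀) = w.getVert (a₀ + 1)`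
    have := hinj (by omega) (by have := hbn k; have := hmb k; omega) (by omega) (by omega) h1
    have := h0a k
    omega
  have hfaceW₀ : ∀ k, ∀ i ≤ m k, w.getVert (a k + 1 + i) = W₀.getVert (j k + i) := by
    intro k i hi
    rw [hface k i hi, SimpleGraph.Walk.getVert_rotateAt, if_pos (by have := hnowrap k; omega)]
  /- S5: the index intervals `[j k, j k + m k]` are pairwise disjoint -/
  have hdisj : ∀ k k', k ≠ k' → ∀ t, j k ≤ t → t ≤ j k + m k → j k' ≤ t → t ≤ j k' + m k' → False := by
    intro k k' hkk' t h1 h2 h3 h4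
    have e1 := hfaceW₀ k (t - j k) (by omega)
    have e2 := hfaceW₀ k' (t - j k') (by omega)
    rw [show j k + (t - j k) = t by omega] at e1
    rw [show j k' + (t - j k') = t by omega] at e2
    have := hinj (by omega) (by have := hbn k; have := hmb k; omega) (by omega) (by have := hbn k'; have := hmb k'; omega)
      (e1.trans e2.symm)
    rcases hdis k k' hkk' with h | h
    · have := hmb k; omega
    · have := hmb k'; omega
  have hjinj : Function.Injective j := by
    intro k k' h
    by_contra hkk'
    exact hdisj k k' hkk' (j k) le_rfl (by omega) (by rw [h]) (by rw [h]; omega)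
  /- S6: sort the three stretches by their position in `W₀` -/
  set S : Finset ℕ := Finset.univ.image j with hS
  have hcard : S.card = 3 := by
    rw [hS, Finset.card_image_of_injective _ hjinj]; simp
  set emb := S.orderEmbOfFin hcard with hemb
  have hmemS : ∀ i : Fin 3, ∃ k, j k = emb i := fun i ↦ by
    have : emb i ∈ S := Finset.orderEmbOfFin_mem S hcard i
    rw [hS, Finset.mem_image] at this
    obtain ⟨k, -, hk⟩ := this
    exact ⟨k, hk⟩
  choose kOf hkOf using hmemS
  refine hW₀.hasTraversals_of_vertices hδ (fun i ↦ j (kOf i)) (fun i ↦ j (kOf i) + m (kOf i)) (fun i ↦ by have := hm1 (kOf i); omega)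
    (fun i ↦ hnowrap (kOf i)) (fun i i' hii' ↦ ?_) (fun i ↦ ?_)
  · -- separation from disjointness and the order of the starts
    have hlt' : j (kOf i) < j (kOf i') := by rw [hkOf, hkOf]; exact emb.strictMono hii'
    have hne : kOf i ≠ kOf i' := fun h ↦ by rw [h] at hlt'; exact lt_irrefl _ hlt'
    by_contra hle
    push Not at hle
    exact hdisj (kOf i) (kOf i') hne (j (kOf i')) hlt'.le hle le_rfl (by omega)
  · -- radial data at the two ends
    have eα : polyPt δ W₀ (j (kOf i)) = (δ : ℂ) * hexCenter (w.getVert (a (kOf i) + 1)) := by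
      rw [polyPt, hjF]
    have eβ : polyPt δ W₀ (j (kOf i) + m (kOf i)) = (δ : ℂ) * hexCenter (w.getVert (b (kOf i))) := by
      rw [polyPt, ← hfaceW₀ (kOf i) (m (kOf i)) le_rfl, hmb]
    simp only [dist_zero_right, eα, eβ]
    exact hends (kOf i)


/-! ### The dichotomy: two crossing loops with different traces, or one loop traversing three times -/

/-- **Four alternating arms force, in every finite configuration agreeing with `ω` on the annulus,
either two interface loops with different traces both crossing the shell, or one interface loop
traversing it three times in time.** For `ω ∈ altFourArm r R` (`1 ≤ r ≤ R`), a configuration `ξ`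
with finitely many open sites agreeing with `ω` on `{r ≤ |·|_𝕋 ≤ R}` (e.g. the restriction of `ω`
to the mesh points of a large domain, whose interface loops form the loop collection of
`CLE6.lean`), and a mesh `δ > 0`: either there are interface loops `W₁, W₂` of `ξ` with different
traces, each trace having a point of norm `≤ δ r` and a point of norm `≥ (√3/2) δ (R+1) - δ`, or
there is an interface loop `W` of `ξ` whose polygon has three separate traversals of the shell
`D(0; δ r + 2δ, (√3/2) δ (R+1) - 3δ)`. This is the lattice content of the upper half of the
identification of the alternating four-arm event with the shell-traversal event of the loop
ensemble (`loopShellTraversal`, `AltFourArmLiminfFromLoops.lean`). [cite: SmirnovWernerMRL2001, §4 Remark 6 and (15)] [cite: GarbanPeteSchramm2013Pivotal, §2.4] [cite: CamiaNewman2006, §2 and §4] -/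
theorem exists_interfaceLoops_of_mem_altFourArm {ω : SiteConfig (Site 2)} {r R : ℕ} (hr : 1 ≤ r) (hrR : r ≤ R)
    (hω : ω ∈ altFourArm r R) {ξ : SiteConfig (Site 2)} (hfin : ξ.Finite)
    (hagree : ∀ v : Site 2, (r : ℤ) ≤ triNorm v ∧ triNorm v ≤ R → (v ∈ ξ ↔ v ∈ ω)) {δ : ℝ} (hδ : 0 < δ) :
    (∃ (f₁ f₂ : HexVertex) (W₁ : hexGraph.Walk f₁ f₁) (W₂ : hexGraph.Walk f₂ f₂),
        IsSiteInterfaceLoop ξ W₁ ∧ IsSiteInterfaceLoop ξ W₂ ∧ polyTrace δ W₁ ≠ polyTrace δ W₂ ∧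
        ((∃ z ∈ polyTrace δ W₁, ‖z‖ ≤ δ * r) ∧ ∃ z ∈ polyTrace δ W₁, Real.sqrt 3 / 2 * δ * (R + 1) - δ ≤ ‖z‖) ∧
        ((∃ z ∈ polyTrace δ W₂, ‖z‖ ≤ δ * r) ∧ ∃ z ∈ polyTrace δ W₂, Real.sqrt 3 / 2 * δ * (R + 1) - δ ≤ ‖z‖)) ∨
    ∃ (f : HexVertex) (W : hexGraph.Walk f f), IsSiteInterfaceLoop ξ W ∧
        (hexLoopCurve δ W).HasTraversals 3 0 (δ * r + 2 * δ) (Real.sqrt 3 / 2 * δ * (R + 1) - δ - 2 * δ) := by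
  obtain ⟨F₀, w, hw, a₀, b₀, a₁, b₁, a₂, b₂, a₃, b₃, hab₀, h01, hab₁, h12, hab₂, h23, hab₃, hb₃, hann,
    ⟨hA₀, hB₀⟩, ⟨hA₁, hB₁⟩, ⟨hA₂, hB₂⟩, ⟨hA₃, hB₃⟩⟩ := exists_four_annulus_stretches_of_mem_altFourArm hr hrR hω
  set n := w.length with hn
  -- nonempty stretches
  have hlt₀ := lt_of_inner_outer_faces hrR hab₀ hA₀ hB₀
  have hlt₁ := lt_of_outer_inner_faces hrR hab₁ hA₁ hB₁
  have hlt₂ := lt_of_inner_outer_faces hrR hab₂ hA₂ hB₂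
  have hlt₃ := lt_of_outer_inner_faces hrR hab₃ hA₃ hB₃
  -- the four loops of `ξ`
  obtain ⟨W₀, hW₀, hpre₀⟩ := exists_isSiteInterfaceLoop_carrying_stretch hw hlt₀ (by omega)
    (fun j h1 h2 ↦ hann j (Or.inl ⟨h1, h2⟩)) hfin hagree
  obtain ⟨W₁, hW₁, hpre₁⟩ := exists_isSiteInterfaceLoop_carrying_stretch hw hlt₁ (by omega)
    (fun j h1 h2 ↦ hann j (Or.inr (Or.inl ⟨h1, h2⟩))) hfin hagree
  obtain ⟨W₂, hW₂, hpre₂⟩ := exists_isSiteInterfaceLoop_carrying_stretch hw hlt₂ (by omega)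
    (fun j h1 h2 ↦ hann j (Or.inr (Or.inr (Or.inl ⟨h1, h2⟩)))) hfin hagree
  obtain ⟨W₃, hW₃, hpre₃⟩ := exists_isSiteInterfaceLoop_carrying_stretch hw hlt₃ hb₃
    (fun j h1 h2 ↦ hann j (Or.inr (Or.inr (Or.inr ⟨h1, h2⟩)))) hfin hagree
  -- each loop crosses: the centres of its end faces are trace points within `δ r` / beyond `Rad`
  have hcross : ∀ {a b : ℕ} {F : HexVertex} {W : hexGraph.Walk F F}, IsSiteInterfaceLoop ξ W →
      (∀ i ≤ b - 1 - a, w.getVert (a + 1 + i) = W.getVert (i % W.length)) → a + 1 < b →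
      ((∃ v ∈ hexFaceVertices (w.getVert (a + 1)), triNorm v < r) ∧ ∃ v ∈ hexFaceVertices (w.getVert b), (R : ℤ) < triNorm v) ∨
      ((∃ v ∈ hexFaceVertices (w.getVert (a + 1)), (R : ℤ) < triNorm v) ∧ ∃ v ∈ hexFaceVertices (w.getVert b), triNorm v < r) →
      (∃ z ∈ polyTrace δ W, ‖z‖ ≤ δ * r) ∧ ∃ z ∈ polyTrace δ W, Real.sqrt 3 / 2 * δ * (R + 1) - δ ≤ ‖z‖ := by
    intro a b F W hW hpre hab hface
    have hlen : 0 < W.length := by have := hW.three_le_length; omega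
    have hstart : (δ : ℂ) * hexCenter (w.getVert (a + 1)) ∈ polyTrace δ W := by
      have e := hpre 0 (Nat.zero_le _)
      rw [add_zero, Nat.zero_mod] at e
      rw [e]
      exact hexCenter_getVert_mem_polyTrace W hlen δ (i := 0) (Nat.zero_le _)
    have hend : (δ : ℂ) * hexCenter (w.getVert b) ∈ polyTrace δ W := by
      have e := hpre (b - 1 - a) le_rfl
      rw [show a + 1 + (b - 1 - a) = b by omega] at e
      rw [e]
      exact hexCenter_getVert_mem_polyTrace W hlen δ (Nat.mod_lt _ hlen).le
    rcases hface with ⟨hA, hB⟩ | ⟨hA, hB⟩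
    · exact ⟨⟨_, hstart, norm_hexCenter_le_of_inner hδ hA⟩, _, hend, le_norm_hexCenter_of_outer hδ hB⟩
    · exact ⟨⟨_, hend, norm_hexCenter_le_of_inner hδ hB⟩, _, hstart, le_norm_hexCenter_of_outer hδ hA⟩
  have hc₀ := hcross hW₀ hpre₀ hlt₀ (Or.inl ⟨hA₀, hB₀⟩)
  have hc₁ := hcross hW₁ hpre₁ hlt₁ (Or.inr ⟨hA₁, hB₁⟩)
  have hc₂ := hcross hW₂ hpre₂ hlt₂ (Or.inl ⟨hA₂, hB₂⟩)
  have hc₃ := hcross hW₃ hpre₃ hlt₃ (Or.inr ⟨hA₃, hB₃⟩)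
  by_cases hall : polyTrace δ W₁ = polyTrace δ W₀ ∧ polyTrace δ W₂ = polyTrace δ W₀ ∧ polyTrace δ W₃ = polyTrace δ W₀
  · -- all four loops have one trace: three traversals of `W₀`
    right
    obtain ⟨ht₁, ht₂, ht₃⟩ := hall
    refine ⟨_, W₀, hW₀, ?_⟩
    let av : Fin 3 → ℕ := ![a₁, a₂, a₃]
    let bv : Fin 3 → ℕ := ![b₁, b₂, b₃]
    let fv : Fin 3 → HexVertex := fun k ↦ w.getVert (av k + 1)
    let Wv : ∀ k : Fin 3, hexGraph.Walk (fv k) (fv k) := fun k ↦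
      match k with
      | ⟨0, _⟩ => W₁
      | ⟨1, _⟩ => W₂
      | ⟨2, _⟩ => W₃
    refine hasTraversals_three_of_stretches_same_trace hw.isCycle hδ hlt₀ (show b₀ ≤ w.length by omega) av bv
      (fun k ↦ ?_) (fun k ↦ ?_) (fun k ↦ ?_) (fun k k' hkk' ↦ ?_) rfl hW₀ (f := fv) (fun k ↦ rfl) Wv
      (fun k ↦ ?_) (fun k ↦ ?_) (fun k ↦ ?_) (fun k ↦ ?_)
    · fin_cases k; exacts [hlt₁, hlt₂, hlt₃]
    · fin_cases k; exacts [show b₁ ≤ w.length by omega, show b₂ ≤ w.length by omega, hb₃]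
    · fin_cases k; exacts [show b₀ ≤ a₁ from h01, show b₀ ≤ a₂ by omega, show b₀ ≤ a₃ by omega]
    · fin_cases k <;> fin_cases k'
      · exact absurd rfl hkk'
      · exact Or.inl (show b₁ ≤ a₂ from h12)
      · exact Or.inl (show b₁ ≤ a₃ by omega)
      · exact Or.inr (show b₁ ≤ a₂ from h12)
      · exact absurd rfl hkk'
      · exact Or.inl (show b₂ ≤ a₃ from h23)
      · exact Or.inr (show b₁ ≤ a₃ by omega)
      · exact Or.inr (show b₂ ≤ a₃ from h23)
      · exact absurd rfl hkk'
    · fin_cases k; exacts [hW₁, hW₂, hW₃]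
    · fin_cases k; exacts [hpre₁, hpre₂, hpre₃]
    · fin_cases k; exacts [ht₁, ht₂, ht₃]
    · fin_cases k
      · exact Or.inr ⟨le_norm_hexCenter_of_outer hδ hA₁, norm_hexCenter_le_of_inner hδ hB₁⟩
      · exact Or.inl ⟨norm_hexCenter_le_of_inner hδ hA₂, le_norm_hexCenter_of_outer hδ hB₂⟩
      · exact Or.inr ⟨le_norm_hexCenter_of_outer hδ hA₃, norm_hexCenter_le_of_inner hδ hB₃⟩
  · -- some loop has a different trace: two crossing loops with different traces
    left
    simp only [not_and_or] at hall
    rcases hall with h | h | h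
    · exact ⟨_, _, W₁, W₀, hW₁, hW₀, h, hc₁, hc₀⟩
    · exact ⟨_, _, W₂, W₀, hW₂, hW₀, h, hc₂, hc₀⟩
    · exact ⟨_, _, W₃, W₀, hW₃, hW₀, h, hc₃, hc₀⟩


/-! ### Read on the Camia–Newman loop collection -/

/-- **Four alternating arms give a fourfold shell traversal of the loop collection.** For
`ω ∈ altFourArm r R` (`1 ≤ r ≤ R`), a mesh `δ > 0` and a Jordan domain `D ⊇ B̄(0, δ R)` (so that
the annulus sites are mesh points of `D`), the loop collection `triLoopCollection D δ ω`
(Camia–Newman: the classes `siteLoopCurve δ W` of the interface loops `W` of the configuration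
restricted to the mesh points of `D`) either has a member with a representative having three
separate traversals of the round shell `D(0; δ (r + 2), (√3/2) δ (R + 1) - 3δ)`, or has two members
with different traces, each trace meeting `{|z| ≤ δ r}` and `{|z| ≥ (√3/2) δ (R + 1) - δ}` — the
event `loopShellTraversal` of the loop ensemble read at these radii
(`exists_interfaceLoops_of_mem_altFourArm` applied to the restricted configuration, which is
finite, `triMeshVertices_finite`, and agrees with `ω` on the annulus). This is the lattice half
of "`ω ∈ altFourArm` ⇒ four crossings of the shell by the loop ensemble".
[cite: SmirnovWernerMRL2001, §4 Remark 6 and (15)] [cite: GarbanPeteSchramm2013Pivotal, §2.4] [cite: CamiaNewman2006, §2 and Thms 1–3] -/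
theorem triLoopCollection_traversals_of_mem_altFourArm {ω : SiteConfig (Site 2)} {r R : ℕ} (hr : 1 ≤ r) (hrR : r ≤ R)
    (hω : ω ∈ altFourArm r R) {δ : ℝ} (hδ : 0 < δ) (D : JordanDomain)
    (hD : closedBall (0 : ℂ) (δ * R) ⊆ D.carrier) :
    (∃ γ : Curve ℂ, CurveClass.mk γ ∈ triLoopCollection D δ ω ∧
        γ.HasTraversals 3 0 (δ * r + 2 * δ) (Real.sqrt 3 / 2 * δ * (R + 1) - δ - 2 * δ)) ∨
    ∃ c₁ ∈ triLoopCollection D δ ω, ∃ c₂ ∈ triLoopCollection D δ ω,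
      CurveClass.range c₁ ≠ CurveClass.range c₂ ∧
      ((∃ z ∈ CurveClass.range c₁, ‖z‖ ≤ δ * r) ∧
        ∃ z ∈ CurveClass.range c₁, Real.sqrt 3 / 2 * δ * (R + 1) - δ ≤ ‖z‖) ∧
      ((∃ z ∈ CurveClass.range c₂, ‖z‖ ≤ δ * r) ∧
        ∃ z ∈ CurveClass.range c₂, Real.sqrt 3 / 2 * δ * (R + 1) - δ ≤ ‖z‖) := by
  set ξ : SiteConfig (Site 2) := ω ∩ triMeshVertices D.carrier δ with hξ
  have hfin : ξ.Finite := (triMeshVertices_finite_holds D.isBounded hδ).subset inter_subset_right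
  -- the restricted configuration agrees with `ω` on the annulus
  have hagree : ∀ v : Site 2, (r : ℤ) ≤ triNorm v ∧ triNorm v ≤ R → (v ∈ ξ ↔ v ∈ ω) := by
    intro v hv
    have hvD : v ∈ triMeshVertices D.carrier δ := by
      change triMeshPoint δ v ∈ D.carrier
      refine hD (mem_closedBall_zero_iff.2 ?_)
      rw [norm_triMeshPoint_eq hδ.le]
      refine mul_le_mul_of_nonneg_left ((norm_triEmbed_le_triNorm v).trans ?_) hδ.le
      exact_mod_cast hv.2
    exact ⟨fun h ↦ h.1, fun h ↦ ⟨h, hvD⟩⟩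
  have hrange : ∀ {F : HexVertex} {W : hexGraph.Walk F F}, IsSiteInterfaceLoop ξ W →
      CurveClass.range (siteLoopCurve δ W) = polyTrace δ W := by
    intro F W hW
    rw [siteLoopCurve, CurveClass.range_mk]
    exact range_toCurve_eq_polyTrace (by have := hW.three_le_length; omega)
  rcases exists_interfaceLoops_of_mem_altFourArm hr hrR hω hfin hagree hδ with
    ⟨f₁, f₂, W₁, W₂, hW₁, hW₂, hne, h₁, h₂⟩ | ⟨f, W, hW, htr⟩
  · right
    refine ⟨siteLoopCurve δ W₁, siteLoopCurve_mem_triLoopCollection hW₁, siteLoopCurve δ W₂,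
      siteLoopCurve_mem_triLoopCollection hW₂, ?_, ?_, ?_⟩
    · rwa [hrange hW₁, hrange hW₂]
    · rwa [hrange hW₁]
    · rwa [hrange hW₂]
  · left
    exact ⟨hexLoopCurve δ W, siteLoopCurve_mem_triLoopCollection hW, htr⟩

end Literature.Probability.Percolation
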